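import Summits.SmoothPoincare4.SmoothPoincare4.Theses.EntropyRung
import Summits.SmoothPoincare4.SmoothPoincare4.Theorems.EntropyRungSubcylindricalExistenceEntropyLocalisation
import Literature.Geometry.Riemannian.BakryEmeryHeatFlow
import Literature.Geometry.Riemannian.PerelmanEntropyCutoff
import Literature.Geometry.Lorentzian.CurvatureSymmetries
import Literature.Geometry.Riemannian.CanonicalNeighbourhoodScaling
import HarnessLib

/-!
# Comparison of weighted `𝒲`-clauses under a `C¹`-small change of weight (helper H3)

Helper for the crux `SubcylindricalExistence` (ENT), route `EntropyRung`, line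
`green-blowup-conformal-entropy`, Stub D. On `(M, g, dV_g)` the `w²`-form of Perelman's `𝒲` for
`φ² g` is `∫ (τ (r w² + 4 φ⁻² |∇w|²) − w² log w² − 4 w²) c φ⁴ dV_g`, `c = (4πτ)⁻²`.
**`wClause_weight_comparison`:** if on an open `U`, `e^{-κ} ≤ φ₁/φ₀ ≤ e^{κ}`,
`φ₀⁻²|∇ log(φ₁/φ₀)|² ≤ κ'²`, `r₁ ≥ r₀ − κ'' `, `r₀ ≥ 0`, and the `φ₀`-clause holds at level `L` at
every scale for test functions supported in `U`, then the `φ₁`-functional of every normalised `w`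
supported in `U` is `≥ L + 2 log(1−ε) − 8κ − 16 τ e^{2κ} κ'²/ε − τ κ''` (substitute
`w̃ = (φ₁/φ₀)² w`, `ŵ = s w̃`, `s = (1−ε)e^{−2κ}`, apply the `φ₀`-clause at scale `sτ`; Young's
inequality for the inverse metric bounds the gradient density). Perelman 2002 §3 / Topping 2006
(8.1.8) for the `w`-form; the comparison is folklore.
-/

noncomputable section

open scoped Manifold ContDiff Topology ENNReal NNReal
open Set Filter MeasureTheory
open Literature.Geometry.Lorentzian Literature.Geometry.Riemannian

set_option linter.dupNamespace false

namespace Summit.SmoothPoincare4.SmoothPoincare4.Theorems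

namespace WeightComparison

variable {M : Type} [TopologicalSpace M] [ChartedSpace (EuclideanSpace ℝ (Fin 4)) M] [IsManifold (𝓡 4) ∞ M]
  (g : PseudoRiemannianMetric (𝓡 4) ∞ (EuclideanSpace ℝ (Fin 4)) (TangentSpace (𝓡 4) : M → Type _))

/-! ### Pointwise: Young's inequality for the inverse metric, and the gradient of `e^{-2ℓ} w̃` -/

/-- **Young's inequality for the inverse metric**: `4 t g⁻¹(β, α) ≤ ε g⁻¹(α, α) + 4 t² g⁻¹(β, β) / ε`. -/
theorem four_mul_innerDual_le (hg : g.IsRiemannian) (x : M) (α β : Module.Dual ℝ (TangentSpace (𝓡 4) x)) (t : ℝ) {ε : ℝ} (hε : 0 < ε) :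
    4 * t * g.innerDual x β α ≤ ε * g.innerDual x α α + 4 * t ^ 2 * g.innerDual x β β / ε := by
  have h0 : 0 ≤ g.innerDual x (ε • α - (2 * t) • β) (ε • α - (2 * t) • β) := g.innerDual_self_nonneg hg x _
  have hexp : g.innerDual x (ε • α - (2 * t) • β) (ε • α - (2 * t) • β) = ε ^ 2 * g.innerDual x α α - 4 * ε * t * g.innerDual x β α
        + 4 * t ^ 2 * g.innerDual x β β := by
    rw [g.innerDual_sub_left, g.innerDual_smul_left, g.innerDual_smul_left,
      g.innerDual_comm x α (ε • α - (2 * t) • β), g.innerDual_comm x β (ε • α - (2 * t) • β),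
      g.innerDual_sub_left, g.innerDual_sub_left, g.innerDual_smul_left, g.innerDual_smul_left,
      g.innerDual_smul_left, g.innerDual_smul_left, g.innerDual_comm x α β]
    ring
  rw [hexp] at h0
  have h3 : (ε ^ 2 * g.innerDual x α α - 4 * ε * t * g.innerDual x β α + 4 * t ^ 2 * g.innerDual x β β) / ε
      = ε * g.innerDual x α α - 4 * t * g.innerDual x β α + 4 * t ^ 2 * g.innerDual x β β / ε := by field_simp
  linarith [h3 ▸ div_nonneg h0 hε.le]

omit [IsManifold (𝓡 4) ∞ M] in
/-- The differential of `E = e^{-2ℓ}`: `dE = −2 E dℓ` (as linear maps). -/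
theorem dcov_exp_neg_two_mul {ℓ : M → ℝ} {x : M} (hℓ : MDifferentiableAt (𝓡 4) 𝓘(ℝ, ℝ) ℓ x) :
    (mvfderiv (𝓡 4) (fun y ↦ Real.exp (-2 * ℓ y)) x : TangentSpace (𝓡 4) x →ₗ[ℝ] ℝ) =
      (-2 * Real.exp (-2 * ℓ x)) • (mvfderiv (𝓡 4) ℓ x : TangentSpace (𝓡 4) x →ₗ[ℝ] ℝ) := by
  have hh : HasDerivAt (fun t : ℝ ↦ Real.exp (-2 * t)) (-2 * Real.exp (-2 * ℓ x)) (ℓ x) := by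
    have := ((hasDerivAt_id (ℓ x)).const_mul (-2 : ℝ)).exp
    simpa [mul_comm] using this
  ext v
  rw [LinearMap.smul_apply, ContinuousLinearMap.coe_coe, ContinuousLinearMap.coe_coe, smul_eq_mul]
  exact mvfderiv_real_comp_apply (I := 𝓡 4) (h := fun t : ℝ ↦ Real.exp (-2 * t)) hh hℓ v

/-- **The gradient of `w = e^{-2ℓ} w̃`**: `|∇w|² = e^{-4ℓ} (|∇w̃|² − 4 w̃ g⁻¹(dℓ, dw̃) + 4 w̃² |∇ℓ|²)`. -/
theorem gradSq_exp_neg_two_mul_mul {w v ℓ : M → ℝ} {x : M} (hw : w =ᶠ[𝓝 x] fun y ↦ Real.exp (-2 * ℓ y) * v y)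
    (hℓ : MDifferentiableAt (𝓡 4) 𝓘(ℝ, ℝ) ℓ x) (hv : MDifferentiableAt (𝓡 4) 𝓘(ℝ, ℝ) v x) :
    g.gradSq w x = Real.exp (-2 * ℓ x) ^ 2 * (g.gradSq v x - 4 * v x * g.innerDual x (mvfderiv (𝓡 4) ℓ x : TangentSpace (𝓡 4) x →ₗ[ℝ] ℝ)
            (mvfderiv (𝓡 4) v x : TangentSpace (𝓡 4) x →ₗ[ℝ] ℝ)
        + 4 * v x ^ 2 * g.gradSq ℓ x) := by
  have hE : MDifferentiableAt (𝓡 4) 𝓘(ℝ, ℝ) (fun y ↦ Real.exp (-2 * ℓ y)) x := by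
    have hd : DifferentiableAt ℝ (fun t : ℝ ↦ Real.exp (-2 * t)) (ℓ x) := by fun_prop
    exact hd.comp_mdifferentiableAt hℓ
  have h1 : g.gradSq w x = g.gradSq (fun y ↦ Real.exp (-2 * ℓ y) * v y) x := by
    simp only [PseudoRiemannianMetric.gradSq, mvfderiv_congr_of_eventuallyEq hw]
  rw [h1, EntropyLocalisation.gradSq_mul g hE hv]
  have hgradE : g.gradSq (fun y ↦ Real.exp (-2 * ℓ y)) x = (-2 * Real.exp (-2 * ℓ x)) ^ 2 * g.gradSq ℓ x := by
    simp only [PseudoRiemannianMetric.gradSq, dcov_exp_neg_two_mul hℓ, PseudoRiemannianMetric.innerDual_smul_smul]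
  have hcross : g.innerDual x (mvfderiv (𝓡 4) (fun y ↦ Real.exp (-2 * ℓ y)) x : TangentSpace (𝓡 4) x →ₗ[ℝ] ℝ)
      (mvfderiv (𝓡 4) v x : TangentSpace (𝓡 4) x →ₗ[ℝ] ℝ) =
      (-2 * Real.exp (-2 * ℓ x)) * g.innerDual x (mvfderiv (𝓡 4) ℓ x : TangentSpace (𝓡 4) x →ₗ[ℝ] ℝ)
        (mvfderiv (𝓡 4) v x : TangentSpace (𝓡 4) x →ₗ[ℝ] ℝ) := by
    rw [dcov_exp_neg_two_mul hℓ, g.innerDual_smul_left]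
  rw [hgradE, hcross]
  ring

/-! ### The scalar inequality behind the pointwise comparison -/

/-- **Scalar core of the pointwise comparison** (`m = c W² P⁴`, `s = (1−ε)e^{−2κ}`, Young bound,
`|l| ≤ κ`, `Λ ≤ κ'² P²`, `0 ≤ r₀`, `r₀ − κ'' ≤ r₁`). -/
theorem scalar_core {τ c ε κ κ' κ'' r₀ r₁ P l A Λ B W s : ℝ}
    (hτ : 0 < τ) (hc : 0 < c) (hε : 0 < ε) (hε1 : ε < 1) (hs : s = (1 - ε) * Real.exp (-2 * κ))
    (hl1 : -κ ≤ l) (hl2 : l ≤ κ) (hA : 0 ≤ A) (hΛ : 0 ≤ Λ) (hΛ2 : Λ ≤ κ' ^ 2 * P ^ 2)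
    (hP : 0 < P) (hr₀ : 0 ≤ r₀) (hr : r₀ - κ'' ≤ r₁)
    (hyoung : 4 * W * B ≤ ε * A + 4 * W ^ 2 * Λ / ε) :
    (s * τ) * r₀ * (c * W ^ 2 * P ^ 4) + 4 * (s * τ) * c * P ^ 2 * A - Real.log (s ^ 2) * (c * W ^ 2 * P ^ 4)
        + (2 * Real.log s - τ * κ'' - 16 * τ * Real.exp (2 * κ) * κ' ^ 2 / ε - 4 * κ) * (c * W ^ 2 * P ^ 4)
      ≤ τ * r₁ * (c * W ^ 2 * P ^ 4) + 4 * τ * c * ((Real.exp l * P) ^ 2 * (Real.exp (-2 * l) ^ 2 * (A - 4 * W * B + 4 * W ^ 2 * Λ)))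
        + 4 * l * (c * W ^ 2 * P ^ 4) := by
  set m : ℝ := c * W ^ 2 * P ^ 4 with hm
  have hm0 : 0 ≤ m := by positivity
  have hs0 : 0 < s := by rw [hs]; exact mul_pos (by linarith) (Real.exp_pos _)
  have hs1 : s ≤ 1 := by
    have h1 : Real.exp (-2 * κ) ≤ 1 := by rw [Real.exp_le_one_iff]; linarith
    rw [hs]; nlinarith [Real.exp_pos (-2 * κ)]
  have hT1 : (s * τ) * r₀ * m ≤ τ * r₁ * m + τ * κ'' * m := by
    have h1 : s * τ * r₀ ≤ τ * r₀ := by nlinarith [mul_nonneg hτ.le hr₀]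
    have h2 : τ * r₀ ≤ τ * r₁ + τ * κ'' := by nlinarith
    have h3 : (s * τ * r₀) * m ≤ (τ * r₁ + τ * κ'') * m := mul_le_mul_of_nonneg_right (h1.trans h2) hm0
    linarith [h3]
  set X : ℝ := Real.exp (-2 * l) with hX
  have hX0 : 0 < X := Real.exp_pos _
  have hXlo : Real.exp (-2 * κ) ≤ X := by rw [hX, Real.exp_le_exp]; linarith
  have hXhi : X ≤ Real.exp (2 * κ) := by rw [hX, Real.exp_le_exp]; linarith
  have hEX : (Real.exp l * P) ^ 2 * (Real.exp (-2 * l) ^ 2) = P ^ 2 * X := by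
    have h : Real.exp l ^ 2 * Real.exp (-2 * l) ^ 2 = Real.exp (-2 * l) := by
      rw [← Real.exp_nat_mul, ← Real.exp_nat_mul, ← Real.exp_add]; congr 1; push_cast; ring
    rw [hX]; linear_combination P ^ 2 * h
  have hY : (1 - ε) * A - 4 * W ^ 2 * Λ / ε ≤ A - 4 * W * B + 4 * W ^ 2 * Λ := by
    have : 0 ≤ 4 * W ^ 2 * Λ := by positivity
    linarith
  have hT2 : 4 * (s * τ) * c * P ^ 2 * A - 16 * τ * Real.exp (2 * κ) * κ' ^ 2 / ε * m ≤ 4 * τ * c * ((Real.exp l * P) ^ 2 * (Real.exp (-2 * l) ^ 2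
        * (A - 4 * W * B + 4 * W ^ 2 * Λ))) := by
    have hfac : 0 ≤ 4 * τ * c * (P ^ 2 * X) := by positivity
    have step1 : 4 * τ * c * (P ^ 2 * X) * ((1 - ε) * A - 4 * W ^ 2 * Λ / ε) ≤ 4 * τ * c * (P ^ 2 * X) * (A - 4 * W * B + 4 * W ^ 2 * Λ) :=
      mul_le_mul_of_nonneg_left hY hfac
    have step2 : 4 * τ * c * P ^ 2 * Real.exp (-2 * κ) * ((1 - ε) * A) ≤ 4 * τ * c * P ^ 2 * X * ((1 - ε) * A) := by
      have h1 : 0 ≤ (1 - ε) * A := mul_nonneg (by linarith) hA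
      have h2 : 0 ≤ 4 * τ * c * P ^ 2 := by positivity
      have := mul_le_mul_of_nonneg_left hXlo h2
      exact mul_le_mul_of_nonneg_right this h1
    have step3 : 4 * τ * c * P ^ 2 * X * (4 * W ^ 2 * Λ / ε) ≤ 16 * τ * Real.exp (2 * κ) * κ' ^ 2 / ε * m := by
      have h1 : X * Λ ≤ Real.exp (2 * κ) * (κ' ^ 2 * P ^ 2) := mul_le_mul hXhi hΛ2 hΛ (Real.exp_pos _).le
      have h2 : 0 ≤ 16 * τ * c * P ^ 2 * W ^ 2 / ε := by positivity
      have h3 := mul_le_mul_of_nonneg_left h1 h2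
      have e1 : 4 * τ * c * P ^ 2 * X * (4 * W ^ 2 * Λ / ε) = 16 * τ * c * P ^ 2 * W ^ 2 / ε * (X * Λ) := by ring
      have e2 : 16 * τ * Real.exp (2 * κ) * κ' ^ 2 / ε * m = 16 * τ * c * P ^ 2 * W ^ 2 / ε * (Real.exp (2 * κ) * (κ' ^ 2 * P ^ 2)) := by
        rw [hm]; ring
      rw [e1, e2]; exact h3
    have e3 : 4 * (s * τ) * c * P ^ 2 * A = 4 * τ * c * P ^ 2 * Real.exp (-2 * κ) * ((1 - ε) * A) := by rw [hs]; ring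
    have e0 : 4 * τ * c * ((Real.exp l * P) ^ 2 * (Real.exp (-2 * l) ^ 2 * (A - 4 * W * B + 4 * W ^ 2 * Λ))) =
        4 * τ * c * (P ^ 2 * X) * (A - 4 * W * B + 4 * W ^ 2 * Λ) := by
      rw [← hEX]; ring
    rw [e0, e3]
    have e4 : 4 * τ * c * (P ^ 2 * X) * ((1 - ε) * A - 4 * W ^ 2 * Λ / ε) =
        4 * τ * c * P ^ 2 * X * ((1 - ε) * A) - 4 * τ * c * P ^ 2 * X * (4 * W ^ 2 * Λ / ε) := by
      ring
    rw [e4] at step1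
    linarith [step1, step2, step3]
  have hT3 : -4 * κ * m ≤ 4 * l * m := by nlinarith
  have hlog : Real.log (s ^ 2) = 2 * Real.log s := by rw [Real.log_pow]; push_cast; ring
  rw [hlog]
  nlinarith [hT1, hT2, hT3, hm0]

/-! ### Elementary identities for the densities -/

/-- Expanding the weighted density (isolates the inverse weight). -/
theorem density_expand (τ r φ G W c : ℝ) (hφ : φ ≠ 0) : (τ * (r * W ^ 2 + 4 * (φ⁻¹ ^ 2 * G)) - W ^ 2 * Real.log (W ^ 2) - 4 * W ^ 2) * (c * φ ^ 4) =
      τ * r * (c * W ^ 2 * φ ^ 4) + 4 * τ * c * (φ ^ 2 * G) - (W ^ 2 * Real.log (W ^ 2)) * (c * φ ^ 4) - 4 * (c * W ^ 2 * φ ^ 4) := by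
  field_simp

/-- The normalising constant `(4πt)^{-2}`. -/
theorem normConst_eq {t : ℝ} (ht : 0 < t) : (4 * Real.pi * t) ^ (-(4 : ℝ) / 2) = ((4 * Real.pi * t) ^ 2)⁻¹ := by
  rw [show (-(4 : ℝ) / 2) = -(2 : ℝ) by norm_num, Real.rpow_neg (by positivity), Real.rpow_two]

/-- Rescaling the normalising constant: `(4π s t)^{-2} = (4πt)^{-2} / s²`. -/
theorem normConst_rescale {s t : ℝ} (hs : 0 < s) (ht : 0 < t) :
    (4 * Real.pi * (s * t)) ^ (-(4 : ℝ) / 2) = (4 * Real.pi * t) ^ (-(4 : ℝ) / 2) / s ^ 2 := by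
  rw [normConst_eq (mul_pos hs ht), normConst_eq ht]
  have hπ : (0 : ℝ) < Real.pi := Real.pi_pos
  field_simp

/-- `e^{-2l}` squared times `e^{l}` to the fourth is `1`. -/
theorem exp_neg_two_sq_mul_exp_pow_four (l : ℝ) : Real.exp (-2 * l) ^ 2 * Real.exp l ^ 4 = 1 := by
  rw [← Real.exp_nat_mul, ← Real.exp_nat_mul, ← Real.exp_add]
  convert Real.exp_zero using 2
  push_cast
  ring

/-- `log (e^{-2l})² = -4 l`. -/
theorem log_exp_neg_two_sq (l : ℝ) : Real.log (Real.exp (-2 * l) ^ 2) = -4 * l := by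
  rw [Real.log_pow, Real.log_exp]
  push_cast
  ring

/-! ### Local-to-global continuity and vanishing -/

omit [ChartedSpace (EuclideanSpace ℝ (Fin 4)) M] [IsManifold (𝓡 4) ∞ M] in
/-- A function continuous at the points of an open `U` and locally zero off `U` is continuous. -/
theorem continuous_of_locally {U : Set M} {F : M → ℝ} (h1 : ∀ y ∈ U, ContinuousAt F y) (h2 : ∀ y ∉ U, F =ᶠ[𝓝 y] fun _ ↦ 0) : Continuous F :=
  continuous_iff_continuousAt.2 fun y ↦ by
    by_cases hy : y ∈ U
    · exact h1 y hy
    · exact continuousAt_const.congr_of_eventuallyEq (h2 y hy)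

/-- The gradient square of a function vanishing near a point vanishes there. -/
theorem gradSq_eq_zero_of_eventuallyEq_zero {f : M → ℝ} {x : M} (h : f =ᶠ[𝓝 x] fun _ ↦ 0) : g.gradSq f x = 0 := by
  apply g.gradSq_eq_zero_of_mvfderiv_eq_zero
  rw [mvfderiv_congr_of_eventuallyEq h, mvfderiv_const]

end WeightComparison

open WeightComparison in
/-- **Helper H3 (registered stub `wClause_weight_comparison`) — comparison of weighted
`𝒲`-clauses under a `C¹`-small change of weight.** See the module docstring. -/
theorem wClause_weight_comparison :
    ∀ (M : Type) [TopologicalSpace M] [T2Space M] [SecondCountableTopology M]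
      [ChartedSpace (EuclideanSpace ℝ (Fin 4)) M] [IsManifold (𝓡 4) ∞ M] [CompactSpace M]
      [T3Space M] [MeasurableSpace M] [BorelSpace M]
      (g : PseudoRiemannianMetric (𝓡 4) ∞ (EuclideanSpace ℝ (Fin 4)) (TangentSpace (𝓡 4) : M → Type _))
      [g.HasLeviCivita] (hg : g.IsRiemannian) (U : Set M), IsOpen U →
      ∀ (φ₀ φ₁ r₀ r₁ : M → ℝ), ContMDiffOn (𝓡 4) 𝓘(ℝ, ℝ) ∞ φ₀ U → ContMDiffOn (𝓡 4) 𝓘(ℝ, ℝ) ∞ φ₁ U →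
      ContinuousOn r₀ U → ContinuousOn r₁ U → (∀ x ∈ U, 0 < φ₀ x) → (∀ x ∈ U, 0 < φ₁ x) →
      ∀ (κ κ' κ'' : ℝ), 0 ≤ κ → 0 ≤ κ' → 0 ≤ κ'' →
      (∀ x ∈ U, Real.exp (-κ) ≤ φ₁ x / φ₀ x ∧ φ₁ x / φ₀ x ≤ Real.exp κ) →
      (∀ x ∈ U, (φ₀ x)⁻¹ ^ 2 * g.gradSq (fun y ↦ Real.log (φ₁ y / φ₀ y)) x ≤ κ' ^ 2) →
      (∀ x ∈ U, 0 ≤ r₀ x ∧ r₀ x - κ'' ≤ r₁ x) →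
      ∀ (L : ℝ),
      (∀ τ' : ℝ, 0 < τ' → ∀ v : M → ℝ, ContMDiff (𝓡 4) 𝓘(ℝ, ℝ) ∞ v → tsupport v ⊆ U →
        ∫ x, (4 * Real.pi * τ') ^ (-(4 : ℝ) / 2) * (v x) ^ 2 * (φ₀ x) ^ 4
            ∂(riemannianMeasure (g.toContMDiffRiemannianMetric hg)) = 1 →
          L ≤ ∫ x, (τ' * (r₀ x * (v x) ^ 2 + 4 * ((φ₀ x)⁻¹ ^ 2 * g.gradSq v x))
              - (v x) ^ 2 * Real.log ((v x) ^ 2) - 4 * (v x) ^ 2)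
              * ((4 * Real.pi * τ') ^ (-(4 : ℝ) / 2) * (φ₀ x) ^ 4)
            ∂(riemannianMeasure (g.toContMDiffRiemannianMetric hg))) →
      ∀ (τ ε : ℝ), 0 < τ → 0 < ε → ε < 1 →
      ∀ w : M → ℝ, ContMDiff (𝓡 4) 𝓘(ℝ, ℝ) ∞ w → tsupport w ⊆ U →
        ∫ x, (4 * Real.pi * τ) ^ (-(4 : ℝ) / 2) * (w x) ^ 2 * (φ₁ x) ^ 4
            ∂(riemannianMeasure (g.toContMDiffRiemannianMetric hg)) = 1 →
          L + 2 * Real.log (1 - ε) - 8 * κ - 16 * τ * Real.exp (2 * κ) * κ' ^ 2 / ε - τ * κ'' ≤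
            ∫ x, (τ * (r₁ x * (w x) ^ 2 + 4 * ((φ₁ x)⁻¹ ^ 2 * g.gradSq w x))
                - (w x) ^ 2 * Real.log ((w x) ^ 2) - 4 * (w x) ^ 2)
                * ((4 * Real.pi * τ) ^ (-(4 : ℝ) / 2) * (φ₁ x) ^ 4)
              ∂(riemannianMeasure (g.toContMDiffRiemannianMetric hg)) := by
  intro M _ _ _ _ _ _ _ _ _ g _ hg U hU φ₀ φ₁ r₀ r₁ hφ₀ hφ₁ hr₀c hr₁c h0 h1 κ κ' κ'' hκ hκ' hκ'' hρ hΛ hr L hclause τ ε hτ hε hε1 w hw hsupp hnorm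
  classical
  set μ : Measure M := riemannianMeasure (g.toContMDiffRiemannianMetric hg) with hμ
  set c : ℝ := (4 * Real.pi * τ) ^ (-(4 : ℝ) / 2) with hc
  set s : ℝ := (1 - ε) * Real.exp (-2 * κ) with hs
  set ℓ : M → ℝ := fun y ↦ Real.log (φ₁ y / φ₀ y) with hℓ
  set v : M → ℝ := fun y ↦ if y ∈ U then Real.exp (2 * ℓ y) * w y else 0 with hv
  set u : M → ℝ := fun y ↦ s * v y with hu
  have hs0 : 0 < s := mul_pos (by linarith) (Real.exp_pos _)
  have hc0 : 0 < c := Real.rpow_pos_of_pos (by positivity) _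
  have hτ' : 0 < s * τ := mul_pos hs0 hτ
  have hsne : s ≠ 0 := hs0.ne'
  have hUn : ∀ {y}, y ∈ U → U ∈ 𝓝 y := fun hy ↦ hU.mem_nhds hy
  have hratio : ∀ y ∈ U, Real.exp (ℓ y) = φ₁ y / φ₀ y := fun y hy ↦ Real.exp_log (div_pos (h1 y hy) (h0 y hy))
  have hφ₁eq : ∀ y ∈ U, φ₁ y = Real.exp (ℓ y) * φ₀ y := by intro y hy; rw [hratio y hy, div_mul_cancel₀ _ (h0 y hy).ne']
  have hwv : ∀ y ∈ U, w y = Real.exp (-2 * ℓ y) * v y := fun y hy ↦ by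
    simp only [hv, if_pos hy]; rw [← mul_assoc, ← Real.exp_add, show -2 * ℓ y + 2 * ℓ y = 0 by ring, Real.exp_zero, one_mul]
  have hw_ev0 : ∀ y ∉ U, w =ᶠ[𝓝 y] 0 := fun y hy ↦ notMem_tsupport_iff_eventuallyEq.1 fun h ↦ hy (hsupp h)
  have hv_of_w : ∀ z, w z = 0 → v z = 0 := fun z hz ↦ by simp only [hv]; split_ifs <;> simp [hz]
  have hv_ev0 : ∀ y ∉ U, v =ᶠ[𝓝 y] fun _ ↦ 0 := fun y hy ↦ (hw_ev0 y hy).mono fun z hz ↦ hv_of_w z hz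
  have hu_ev0 : ∀ y ∉ U, u =ᶠ[𝓝 y] fun _ ↦ 0 := fun y hy ↦ (hv_ev0 y hy).mono fun z hz ↦ by simp only [hu, hz, mul_zero]
  have hw_ev0' : ∀ y ∉ U, w =ᶠ[𝓝 y] fun _ ↦ 0 := hw_ev0
  have hwv_ev : ∀ y ∈ U, w =ᶠ[𝓝 y] fun z ↦ Real.exp (-2 * ℓ z) * v z := fun y hy ↦ by filter_upwards [hUn hy] with z hz using hwv z hz
  have hℓs : ∀ y ∈ U, ContMDiffAt (𝓡 4) 𝓘(ℝ, ℝ) ∞ ℓ y := by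
    intro y hy
    have hq : ContMDiffOn (𝓡 4) 𝓘(ℝ, ℝ) ∞ (fun z ↦ φ₁ z / φ₀ z) U := hφ₁.div₀ hφ₀ fun z hz ↦ (h0 z hz).ne'
    have hqy : ContMDiffAt (𝓡 4) 𝓘(ℝ, ℝ) ∞ (fun z ↦ φ₁ z / φ₀ z) y := (hq y hy).contMDiffAt (hUn hy)
    have hne : φ₁ y / φ₀ y ≠ 0 := (div_pos (h1 y hy) (h0 y hy)).ne'
    exact (Real.contDiffAt_log.mpr hne).comp_contMDiffAt (f := fun z ↦ φ₁ z / φ₀ z) hqy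
  have hvs : ContMDiff (𝓡 4) 𝓘(ℝ, ℝ) ∞ v := by
    intro y
    by_cases hy : y ∈ U
    · have hev : v =ᶠ[𝓝 y] fun z ↦ Real.exp (2 * ℓ z) * w z := by
        filter_upwards [hUn hy] with z hz
        simp only [hv, if_pos hz]
      have h2ℓ : ContMDiffAt (𝓡 4) 𝓘(ℝ, ℝ) ∞ (fun z ↦ 2 * ℓ z) y := contMDiffAt_const.mul (hℓs y hy)
      have hexp : ContMDiffAt (𝓡 4) 𝓘(ℝ, ℝ) ∞ (fun z ↦ Real.exp (2 * ℓ z)) y :=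
        Real.contDiff_exp.contDiffAt.comp_contMDiffAt (f := fun z ↦ 2 * ℓ z) h2ℓ
      exact (hexp.mul (hw y)).congr_of_eventuallyEq hev
    · exact contMDiffAt_const.congr_of_eventuallyEq (hv_ev0 y hy)
  have hus : ContMDiff (𝓡 4) 𝓘(ℝ, ℝ) ∞ u := contMDiff_const.mul hvs
  have hsuppu : tsupport u ⊆ U := by
    refine Subset.trans (closure_mono fun z hz ↦ ?_) hsupp
    intro hwz
    exact hz (by simp only [hu, hv_of_w z hwz, mul_zero])
  have hmass : ∀ y, c * (w y) ^ 2 * (φ₁ y) ^ 4 = c * (v y) ^ 2 * (φ₀ y) ^ 4 := by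
    intro y
    by_cases hy : y ∈ U
    · rw [hwv y hy, hφ₁eq y hy]; linear_combination (c * v y ^ 2 * φ₀ y ^ 4) * exp_neg_two_sq_mul_exp_pow_four (ℓ y)
    · rw [(hw_ev0' y hy).eq_of_nhds, (hv_ev0 y hy).eq_of_nhds]; simp
  have hc' : (4 * Real.pi * (s * τ)) ^ (-(4 : ℝ) / 2) = c / s ^ 2 := normConst_rescale hs0 hτ
  have hnormu : ∫ y, (4 * Real.pi * (s * τ)) ^ (-(4 : ℝ) / 2) * (u y) ^ 2 * (φ₀ y) ^ 4 ∂μ = 1 := by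
    have h1 : ∀ y, c / s ^ 2 * (u y) ^ 2 * (φ₀ y) ^ 4 = c * (w y) ^ 2 * (φ₁ y) ^ 4 := fun y ↦ by
      rw [hmass y]; simp only [hu]; field_simp
    rw [hc']; simp_rw [h1]; exact hnorm
  have hL := hclause (s * τ) hτ' u hus hsuppu hnormu
  rw [hc'] at hL
  set K : ℝ := 2 * Real.log s - τ * κ'' - 16 * τ * Real.exp (2 * κ) * κ' ^ 2 / ε - 4 * κ with hK
  have hpt : ∀ y, (s * τ * (r₀ y * (u y) ^ 2 + 4 * ((φ₀ y)⁻¹ ^ 2 * g.gradSq u y))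
          - (u y) ^ 2 * Real.log ((u y) ^ 2) - 4 * (u y) ^ 2) * (c / s ^ 2 * (φ₀ y) ^ 4)
        + K * (c * (v y) ^ 2 * (φ₀ y) ^ 4) ≤
      (τ * (r₁ y * (w y) ^ 2 + 4 * ((φ₁ y)⁻¹ ^ 2 * g.gradSq w y)) - (w y) ^ 2 * Real.log ((w y) ^ 2) - 4 * (w y) ^ 2) * (c * (φ₁ y) ^ 4) := by
    intro y
    by_cases hy : y ∈ U
    · have hP : 0 < φ₀ y := h0 y hy
      have hℓy : MDifferentiableAt (𝓡 4) 𝓘(ℝ, ℝ) ℓ y := (hℓs y hy).mdifferentiableAt (by simp)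
      have hvy : MDifferentiableAt (𝓡 4) 𝓘(ℝ, ℝ) v y := (hvs y).mdifferentiableAt (by simp)
      set P := φ₀ y with hPdef
      set l := ℓ y with hl
      set A := g.gradSq v y with hA
      set Λ := g.gradSq ℓ y with hΛdef
      set B := g.innerDual y (mvfderiv (𝓡 4) ℓ y : TangentSpace (𝓡 4) y →ₗ[ℝ] ℝ) (mvfderiv (𝓡 4) v y : TangentSpace (𝓡 4) y →ₗ[ℝ] ℝ) with hB
      set V := v y with hV
      have hA0 : 0 ≤ A := g.gradSq_nonneg hg v y
      have hΛ0 : 0 ≤ Λ := g.gradSq_nonneg hg ℓ y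
      have hl1 : -κ ≤ l := by have := Real.log_le_log (Real.exp_pos _) (hρ y hy).1; rwa [Real.log_exp] at this
      have hl2 : l ≤ κ := by have := Real.log_le_log (div_pos (h1 y hy) (h0 y hy)) (hρ y hy).2; rwa [Real.log_exp] at this
      have hΛ2 : Λ ≤ κ' ^ 2 * P ^ 2 := by
        have h := hΛ y hy
        have : (φ₀ y)⁻¹ ^ 2 * g.gradSq (fun y ↦ Real.log (φ₁ y / φ₀ y)) y = Λ / P ^ 2 := by rw [hΛdef, hPdef, inv_pow, inv_mul_eq_div]
        rwa [this, div_le_iff₀ (by positivity : 0 < P ^ 2)] at h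
      have hyoung : 4 * V * B ≤ ε * A + 4 * V ^ 2 * Λ / ε := four_mul_innerDual_le g hg y _ _ V hε
      have hgradw : g.gradSq w y = Real.exp (-2 * l) ^ 2 * (A - 4 * V * B + 4 * V ^ 2 * Λ) := gradSq_exp_neg_two_mul_mul g (hwv_ev y hy) hℓy hvy
      have hgradu : g.gradSq u y = s ^ 2 * A := g.gradSq_const_mul v s y
      have hwy : w y = Real.exp (-2 * l) * V := hwv y hy
      have hφ₁y : φ₁ y = Real.exp l * P := hφ₁eq y hy
      have huy : u y = s * V := rfl
      have hE4 := exp_neg_two_sq_mul_exp_pow_four l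
      have hEP : Real.exp l * P ≠ 0 := (mul_pos (Real.exp_pos _) hP).ne'
      rw [hgradw, hgradu, hwy, hφ₁y, huy, density_expand _ _ _ _ _ _ hEP, density_expand _ _ _ _ _ _ hP.ne']
      have hlog1 : (Real.exp (-2 * l) * V) ^ 2 * Real.log ((Real.exp (-2 * l) * V) ^ 2) * (c * (Real.exp l * P) ^ 4) =
          (V ^ 2 * Real.log (V ^ 2)) * (c * P ^ 4) - 4 * l * (c * V ^ 2 * P ^ 4) := by
        rw [EntropyLocalisation.sq_mul_log_sq_mul, log_exp_neg_two_sq]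
        linear_combination (c * P ^ 4 * (V ^ 2 * Real.log (V ^ 2)) - 4 * l * (c * V ^ 2 * P ^ 4)) * hE4
      have hlog0 : (s * V) ^ 2 * Real.log ((s * V) ^ 2) * (c / s ^ 2 * P ^ 4) =
          (V ^ 2 * Real.log (V ^ 2)) * (c * P ^ 4) + Real.log (s ^ 2) * (c * V ^ 2 * P ^ 4) := by
        rw [EntropyLocalisation.sq_mul_log_sq_mul]
        field_simp
      have hm1 : c * (Real.exp (-2 * l) * V) ^ 2 * (Real.exp l * P) ^ 4 = c * V ^ 2 * P ^ 4 := by linear_combination (c * V ^ 2 * P ^ 4) * hE4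
      have hm0 : c / s ^ 2 * (s * V) ^ 2 * P ^ 4 = c * V ^ 2 * P ^ 4 := by field_simp
      have hg0 : 4 * (s * τ) * (c / s ^ 2) * (P ^ 2 * (s ^ 2 * A)) = 4 * (s * τ) * c * P ^ 2 * A := by field_simp
      rw [hlog1, hlog0, hm1, hm0, hg0]
      have key := scalar_core (r₀ := r₀ y) (r₁ := r₁ y) (B := B) (W := V) hτ hc0 hε hε1 hs hl1 hl2 hA0 hΛ0 hΛ2 hP (hr y hy).1 (hr y hy).2 hyoung
      linarith [key]
    · simp [(hw_ev0' y hy).eq_of_nhds, (hv_ev0 y hy).eq_of_nhds, (hu_ev0 y hy).eq_of_nhds,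
        gradSq_eq_zero_of_eventuallyEq_zero g (hw_ev0' y hy), gradSq_eq_zero_of_eventuallyEq_zero g (hu_ev0 y hy)]
  have hμfin : IsFiniteMeasure μ := isFiniteMeasure_riemannianMeasure _
  have hint : ∀ {F : M → ℝ}, Continuous F → Integrable F μ := fun hF ↦ EntropyLocalisation.integrable_of_continuous_finite hF μ
  have hcontI : ∀ {φ r f : M → ℝ} (t k : ℝ), ContMDiffOn (𝓡 4) 𝓘(ℝ, ℝ) ∞ φ U → ContinuousOn r U →
      (∀ x ∈ U, 0 < φ x) → ContMDiff (𝓡 4) 𝓘(ℝ, ℝ) ∞ f → (∀ y ∉ U, f =ᶠ[𝓝 y] fun _ ↦ 0) →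
      Continuous fun y ↦ (t * (r y * (f y) ^ 2 + 4 * ((φ y)⁻¹ ^ 2 * g.gradSq f y))
          - (f y) ^ 2 * Real.log ((f y) ^ 2) - 4 * (f y) ^ 2) * (k * (φ y) ^ 4) := by
    intro φ r f t k hφ hrc hpos hf hf0
    have hfc : Continuous f := hf.continuous
    have hGc : Continuous (g.gradSq f) := (contMDiff_gradSq g hf).continuous
    apply continuous_of_locally (U := U)
    · intro y hy
      have hφy : ContinuousAt φ y := ((hφ y hy).contMDiffAt (hUn hy)).continuousAt
      have hry : ContinuousAt r y := (hrc y hy).continuousAt (hUn hy)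
      have hinv : ContinuousAt (fun z ↦ (φ z)⁻¹) y := hφy.inv₀ (hpos y hy).ne'
      have hf2 : ContinuousAt (fun z ↦ (f z) ^ 2) y := (hfc.pow 2).continuousAt
      have hlog : ContinuousAt (fun z ↦ (f z) ^ 2 * Real.log ((f z) ^ 2)) y := (Real.continuous_mul_log.comp (hfc.pow 2)).continuousAt
      exact ((((continuousAt_const.mul ((hry.mul hf2).add (continuousAt_const.mul ((hinv.pow 2).mul hGc.continuousAt)))).sub hlog).sub
        (continuousAt_const.mul hf2)).mul (continuousAt_const.mul (hφy.pow 4)))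
    · intro y hy
      filter_upwards [hf0 y hy, (hf0 y hy).eventually_nhds] with z hz hzz
      simp [hz, gradSq_eq_zero_of_eventuallyEq_zero g hzz]
  have hI1 : Integrable (fun y ↦ (τ * (r₁ y * (w y) ^ 2 + 4 * ((φ₁ y)⁻¹ ^ 2 * g.gradSq w y))
      - (w y) ^ 2 * Real.log ((w y) ^ 2) - 4 * (w y) ^ 2) * (c * (φ₁ y) ^ 4)) μ :=
    hint (hcontI τ c hφ₁ hr₁c h1 hw hw_ev0')
  have hI0 : Integrable (fun y ↦ (s * τ * (r₀ y * (u y) ^ 2 + 4 * ((φ₀ y)⁻¹ ^ 2 * g.gradSq u y))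
      - (u y) ^ 2 * Real.log ((u y) ^ 2) - 4 * (u y) ^ 2) * (c / s ^ 2 * (φ₀ y) ^ 4)) μ :=
    hint (hcontI (s * τ) (c / s ^ 2) hφ₀ hr₀c h0 hus hu_ev0)
  have hvw : (fun y ↦ c * (v y) ^ 2 * (φ₀ y) ^ 4) = fun y ↦ c * (w y) ^ 2 * (φ₁ y) ^ 4 := funext fun y ↦ (hmass y).symm
  have hIm : Integrable (fun y ↦ c * (v y) ^ 2 * (φ₀ y) ^ 4) μ := by
    rw [hvw]
    refine hint (continuous_of_locally (U := U) (fun y hy ↦ ?_) fun y hy ↦ (hw_ev0' y hy).mono fun z hz ↦ by simp [hz])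
    exact (continuousAt_const.mul ((hw.continuous.pow 2).continuousAt)).mul
      (((hφ₁ y hy).contMDiffAt (hUn hy)).continuousAt.pow 4)
  have hmass_int : ∫ y, c * (v y) ^ 2 * (φ₀ y) ^ 4 ∂μ = 1 := by rw [hvw]; exact hnorm
  have hstep : (∫ y, (s * τ * (r₀ y * (u y) ^ 2 + 4 * ((φ₀ y)⁻¹ ^ 2 * g.gradSq u y))
      - (u y) ^ 2 * Real.log ((u y) ^ 2) - 4 * (u y) ^ 2) * (c / s ^ 2 * (φ₀ y) ^ 4) ∂μ)
      + K * ∫ y, c * (v y) ^ 2 * (φ₀ y) ^ 4 ∂μ ≤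
      ∫ y, (τ * (r₁ y * (w y) ^ 2 + 4 * ((φ₁ y)⁻¹ ^ 2 * g.gradSq w y)) - (w y) ^ 2 * Real.log ((w y) ^ 2) - 4 * (w y) ^ 2) * (c * (φ₁ y) ^ 4) ∂μ := by
    rw [← integral_const_mul, ← integral_add hI0 (hIm.const_mul K)]
    exact integral_mono (hI0.add (hIm.const_mul K)) hI1 fun y ↦ hpt y
  rw [hmass_int, mul_one] at hstep
  have hlogs : Real.log s = Real.log (1 - ε) + -2 * κ := by rw [hs, Real.log_mul (by linarith) (Real.exp_pos _).ne', Real.log_exp]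
  have hKval : K = 2 * Real.log (1 - ε) - 4 * κ - τ * κ'' - 16 * τ * Real.exp (2 * κ) * κ' ^ 2 / ε - 4 * κ := by rw [hK, hlogs]; ring
  linarith [hL, hstep, hKval]

end Summit.SmoothPoincare4.SmoothPoincare4.Theorems

end
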